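import Mathlib
import Literature.Computability.MetaComplexity.SmolenskyDimensionBound
import Literature.Computability.MetaComplexity.TruthTables

/-!
# Vocabulary of the Liouville Annihilator Rank (route `MobiusLadder`, crux `DigitPolyUniformity`, line `Sketch`/LAR)

Definitions posited by line `Sketch` (composition LAR, cards `smolensky-immunity` of crux
stmt-QuantumAdvantage-1392) for its transferred crux, the LIOUVILLE ANNIHILATOR RANK statement, and the
small API the composition and the promoted item use:

* `vanishOn F Y` — the subspace of functions on the cube `{0,1}ⁿ` vanishing on `Y`;
* `annRank F n k Y = dim (lowDeg F n k ⊓ vanishOn F Y)` — the ANNIHILATOR RANK: the dimension of the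
  space of multilinear polynomials of degree `≤ k` over `F` vanishing on `Y` (for `F = 𝔽₂`: the number of
  independent `RM(k,n)`-codewords supported in `Yᶜ`; `min {k : annRank_k (supp f) ≠ 0 ∨ annRank_k (supp (1+f)) ≠ 0}`
  is the ALGEBRAIC IMMUNITY of `f`, Meier–Pasalic–Carlet, EUROCRYPT 2004; Carlet, CRYPTO 2006);
* `liouSet n` — the Liouville digit set `{b ∈ {0,1}ⁿ : λ(val b) = −1}`, `val b = Σ bᵢ2ⁱ` read through the
  tree's enumeration `boolFunEquivFin n : (Fin n → Bool) ≃ Fin (2ⁿ)` (least significant bit first);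
* API: `mem_vanishOn`, `vanishOn_mono`, `annRank_mono_left` (monotone in the degree), `annRank_anti`
  (antitone in the set), `annRank_le_finrank_lowDeg`, `annRank_empty`, `forced_le_annRank`
  (`dim lowDeg k ≤ |Y| + annRank_k Y`: the annihilators forced by counting).

Built on the tree's Smolensky algebra (`Literature.Computability.MetaComplexity.Smolensky.{CubeFn, mono, lowDeg}`).
No statement of the route is restated here; the open transferred crux `stub_LAR` lives in the line's
skeleton (`Cruxes/DigitPolyUniformity/Lines/SketchLAR.lean`).
-/

noncomputable section

namespace Summit.QuantumAdvantage.DigitPolyUniformity.SketchLAR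

open Finset Module
open Literature.Computability.MetaComplexity (boolFunEquivFin)
open Literature.Computability.MetaComplexity.Smolensky (CubeFn mono lowDeg)

variable {F : Type*} [Field F] {n : ℕ}

/-- The space of functions on the cube `{0,1}ⁿ` vanishing on a set `Y` (for `Y = supp f` its
degree-`≤ k` part is the space of degree-`≤ k` ANNIHILATORS of `f`). [folklore] -/
def vanishOn (F : Type*) [Field F] {n : ℕ} (Y : Set (Fin n → Bool)) : Submodule F (CubeFn F n) where
  carrier := {h | ∀ b ∈ Y, h b = 0}
  add_mem' := by
    intro u v hu hv b hb
    simp only [Pi.add_apply, hu b hb, hv b hb, add_zero]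
  zero_mem' := by
    intro b _
    rfl
  smul_mem' := by
    intro c u hu b hb
    simp only [Pi.smul_apply, hu b hb, smul_zero]

/-- Membership in `vanishOn` (definitional). [folklore] -/
theorem mem_vanishOn {Y : Set (Fin n → Bool)} {h : CubeFn F n} :
    h ∈ vanishOn F Y ↔ ∀ b ∈ Y, h b = 0 :=
  Iff.rfl

/-- `vanishOn` is antitone in the set: vanishing on a larger set is a stronger condition. [folklore] -/
theorem vanishOn_mono {Y Z : Set (Fin n → Bool)} (hYZ : Y ⊆ Z) : vanishOn F Z ≤ vanishOn F Y :=
  fun _ hh b hb => hh b (hYZ hb)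

/-- Everything vanishes on the empty set. [folklore] -/
@[simp] theorem vanishOn_empty : vanishOn F (∅ : Set (Fin n → Bool)) = ⊤ :=
  top_le_iff.1 fun _ _ b hb => absurd hb (Set.notMem_empty b)

/-- The ANNIHILATOR RANK `annRank F n k Y = dim {h : deg h ≤ k, h|_Y = 0}`: the dimension of the space
of degree-`≤ k` multilinear polynomials over `F` (Smolensky's `lowDeg F n k`) vanishing on
`Y ⊆ {0,1}ⁿ` — for `F = 𝔽₂` the number of independent `RM(k, n)`-codewords supported in `Yᶜ`; the
least `k` with `annRank_k (supp f) + annRank_k (supp (1 + f)) ≠ 0` is the algebraic immunity of `f`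
(Meier–Pasalic–Carlet 2004; Carlet 2006). [folklore] -/
def annRank (F : Type*) [Field F] (n k : ℕ) (Y : Set (Fin n → Bool)) : ℕ :=
  Module.finrank F ↥(lowDeg F n k ⊓ vanishOn F Y)

/-- Unfolding lemma for `annRank`. [folklore] -/
theorem annRank_eq (k : ℕ) (Y : Set (Fin n → Bool)) :
    annRank F n k Y = Module.finrank F ↥(lowDeg F n k ⊓ vanishOn F Y) :=
  rfl

/-- The annihilator rank is monotone in the degree. [folklore] -/
theorem annRank_mono_left {k k' : ℕ} (hkk' : k ≤ k') (Y : Set (Fin n → Bool)) :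
    annRank F n k Y ≤ annRank F n k' Y :=
  Submodule.finrank_mono
    (inf_le_inf_right _ (Literature.Computability.MetaComplexity.Smolensky.lowDeg_mono hkk'))

/-- The annihilator rank is antitone in the set. [folklore] -/
theorem annRank_anti (k : ℕ) {Y Z : Set (Fin n → Bool)} (hYZ : Y ⊆ Z) :
    annRank F n k Z ≤ annRank F n k Y :=
  Submodule.finrank_mono (inf_le_inf_left _ (vanishOn_mono hYZ))

/-- Trivial upper bound: `annRank_k Y ≤ dim lowDeg k`. [folklore] -/
theorem annRank_le_finrank_lowDeg (k : ℕ) (Y : Set (Fin n → Bool)) :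
    annRank F n k Y ≤ Module.finrank F ↥(lowDeg F n k) :=
  Submodule.finrank_mono inf_le_left

/-- On the empty set every low-degree polynomial is an annihilator. [folklore] -/
theorem annRank_empty (k : ℕ) :
    annRank F n k (∅ : Set (Fin n → Bool)) = Module.finrank F ↥(lowDeg F n k) := by
  rw [annRank_eq, vanishOn_empty, inf_top_eq]

/-- **Annihilators forced by counting**: `dim lowDeg k ≤ |Y| + annRank_k Y` for a finite `Y` (the
annihilators of `Y` in `lowDeg k` are the kernel of the restriction map to `F^Y`, of rank `≤ |Y|`).
In particular `annRank_k Y ≥ Σ_{i ≤ k} C(n,i) − |Y| > 0` as soon as `k` is above the level where the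
monomial count exceeds `|Y|`. [folklore] -/
theorem forced_le_annRank (k : ℕ) (Y : Finset (Fin n → Bool)) :
    Module.finrank F ↥(lowDeg F n k) ≤ Y.card + annRank F n k (Y : Set (Fin n → Bool)) := by
  classical
  -- restriction to `Y`
  let r : CubeFn F n →ₗ[F] (↥Y → F) := LinearMap.funLeft F F (Subtype.val : ↥Y → (Fin n → Bool))
  have hker : LinearMap.ker r = vanishOn F (Y : Set (Fin n → Bool)) := by
    ext h
    simp only [LinearMap.mem_ker, mem_vanishOn, Finset.mem_coe]
    constructor
    · intro h0 b hb
      have := congrFun h0 ⟨b, hb⟩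
      simpa [r, LinearMap.funLeft_apply] using this
    · intro hh
      funext e
      simpa [r, LinearMap.funLeft_apply] using hh e.1 e.2
  -- `dim (ker r) + |Y| ≥ 2^n`
  have hrn := LinearMap.finrank_range_add_finrank_ker r
  have hrange : Module.finrank F ↥(LinearMap.range r) ≤ Y.card := by
    calc Module.finrank F ↥(LinearMap.range r) ≤ Module.finrank F (↥Y → F) := Submodule.finrank_le _
      _ = Y.card := by rw [Module.finrank_fintype_fun_eq_card, Fintype.card_coe]
  -- `dim L + dim K = dim (L ⊔ K) + dim (L ⊓ K) ≤ 2^n + annRank`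
  have hsup := Submodule.finrank_sup_add_finrank_inf_eq (lowDeg F n k) (LinearMap.ker r)
  have hle : Module.finrank F ↥(lowDeg F n k ⊔ LinearMap.ker r) ≤ Module.finrank F (CubeFn F n) :=
    Submodule.finrank_le _
  rw [hker] at hsup hle hrn
  rw [annRank_eq]
  omega

/-- The LIOUVILLE DIGIT SET on `n` bits: digit vectors `b ∈ {0,1}ⁿ` whose number `val b = Σ bᵢ 2ⁱ`
(the tree's enumeration `boolFunEquivFin`, least significant bit first — `Smolensky.testBit_boolFunEquivFin`)
has `λ(val b) = −1`. Its annihilator-rank profile is the subject of the transferred crux `stub_LAR` of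
line `Sketch`/LAR. [folklore] -/
def liouSet (n : ℕ) : Set (Fin n → Bool) :=
  {b | ArithmeticFunction.liouville ((boolFunEquivFin n b : Fin (2 ^ n)) : ℕ) = -1}

/-- Membership in the Liouville digit set (definitional). [folklore] -/
theorem mem_liouSet {b : Fin n → Bool} :
    b ∈ liouSet n ↔ ArithmeticFunction.liouville ((boolFunEquivFin n b : Fin (2 ^ n)) : ℕ) = -1 :=
  Iff.rfl

end Summit.QuantumAdvantage.DigitPolyUniformity.SketchLAR

end
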